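import Literature.MathematicalPhysics.QuantumLattice.SpinChainsHigherDimLsmParityProofs
import Literature.MathematicalPhysics.QuantumLattice.LocalDynamicsProofs
import Literature.MathematicalPhysics.QuantumLattice.InfiniteVolumeShiftProofs
import HarnessLib

/-!
# Periodic wrapping of a translation-invariant interaction: the finite sum over representatives
# and translation covariance of the torus Hamiltonian

Bookkeeping for the rectangular torus `𝕋 = Π i, ℤ/(Ls i)ℤ` with periodic boundary conditions
(`wrapTerm`, `IsWrapRepresentative`, `rectTorusInteraction`, `rectTorusHamiltonian` of
`LocalDynamics.lean`), needed by the higher-dimensional Lieb–Schultz–Mattis theorem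
(`SpinChains.higherDim_lsm`, Hastings 2004 / Nachtergaele–Sims 2007, which work on the torus and
use the translation `T` by one lattice unit, `[T, H_𝕋] = 0`):

* shifts of regions `X + v = X.map (Site.shift v)` (membership, composition, coordinatewise
  minimum `inf'`, diameter);
* the period vector `wrapShiftVec Ls X ∈ Π i, (Ls i)ℤ` and the normalisation
  `wrapNormalize Ls X = X + wrapShiftVec Ls X`, which moves the coordinatewise minimum of `X` into
  the fundamental domain `Π i, [0, Ls i)`: a small nonempty region becomes a wrap representative
  (`isWrapRepresentative_wrapNormalize`), and a representative shifted by a period vector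
  normalises back to itself (`wrapNormalize_map_shift_of_dvd`);
* the wrap representatives form a finite set `wrapRepSet Ls` (they lie in the box
  `Π i, [0, 2 Ls i)`), so the `finsum` defining `rectTorusInteraction` is a finite sum
  (`rectTorusInteraction_eq_sum`) and `H_𝕋 = Σ_{X ∈ wrapRepSet} wrapTerm Ls X (Φ X)`
  (`rectTorusHamiltonian_eq_sum`);
* covariance of wrapping: `τ_{proj v} (wrapTerm Ls X A) = wrapTerm Ls (X + v) (τ_v A)`
  (`reindexOp_addRight_wrapTerm`); for a translation-invariant `Φ` the wrapped term of `X + v` is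
  the torus translate of the wrapped term of `X`, wrapped terms are invariant under period shifts,
  and — re-summing over representatives via `X ↦ wrapNormalize (X + v)` — **the torus Hamiltonian is
  translation invariant**: `reindexOp (· + proj v) H_𝕋 = H_𝕋`
  (`reindexOp_addRight_rectTorusHamiltonian`).

Definitions with bodies + theorems; no named facts.

## References

* M. B. Hastings, *Lieb–Schultz–Mattis in higher dimensions*, Phys. Rev. B **69** (2004) 104431,
  §II (periodic boundary conditions, translation `T`). [HastingsPRB2004]
* B. Nachtergaele, R. Sims, *A multi-dimensional Lieb–Schultz–Mattis theorem*, Comm. Math. Phys.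
  **276** (2007) 437–472, §1.2 (assumption LSM2: periodicity in the long direction, `[T, H] = 0`).
  [NachtergaeleSimsCMP2007]
* O. Bratteli, D. W. Robinson, *Operator Algebras and Quantum Statistical Mechanics 2*, §6.2.1,
  eqs. (6.2.2)–(6.2.4) (covariant interactions). [BratteliRobinsonII1997]
-/

noncomputable section

namespace Literature.MathematicalPhysics.QuantumLattice

open Matrix Finset
open Literature.Probability.LatticeModels

variable {d q : ℕ}

/-! ### Shifts of regions of `ℤ^d` -/

section Shift

/-- `y ∈ X + v ↔ y - v ∈ X`. Bratteli–Robinson II §6.2.1. [folklore] -/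
theorem mem_map_shift_iff {X : Finset (Site d)} {v y : Site d} :
    y ∈ X.map (Site.shift v).toEmbedding ↔ y - v ∈ X := by
  rw [Finset.mem_map_equiv, Site.shift_symm_apply]

/-- `x + v ∈ X + v ↔ x ∈ X`. Bratteli–Robinson II §6.2.1. [folklore] -/
theorem add_mem_map_shift_iff {X : Finset (Site d)} {v x : Site d} :
    x + v ∈ X.map (Site.shift v).toEmbedding ↔ x ∈ X := by
  rw [mem_map_shift_iff, add_sub_cancel_right]

/-- `(X + v) + w = X + (v + w)`. Bratteli–Robinson II §6.2.1. [folklore] -/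
theorem map_shift_map_shift (X : Finset (Site d)) (v w : Site d) :
    (X.map (Site.shift v).toEmbedding).map (Site.shift w).toEmbedding =
      X.map (Site.shift (v + w)).toEmbedding := by
  ext y
  rw [mem_map_shift_iff, mem_map_shift_iff, mem_map_shift_iff, sub_sub, add_comm w v]

/-- `X + 0 = X`. Bratteli–Robinson II §6.2.1. [folklore] -/
theorem map_shift_zero (X : Finset (Site d)) : X.map (Site.shift (0 : Site d)).toEmbedding = X := by
  ext y
  rw [mem_map_shift_iff, sub_zero]

/-- The coordinatewise minimum of a translate: `min_{X+v} x_i = min_X x_i + v_i`.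
Bratteli–Robinson II §6.2.1. [folklore] -/
theorem inf'_map_shift {X : Finset (Site d)} (hX : X.Nonempty) (v : Site d) (i : Fin d)
    (h' : (X.map (Site.shift v).toEmbedding).Nonempty) :
    (X.map (Site.shift v).toEmbedding).inf' h' (fun x => x i) = X.inf' hX (fun x => x i) + v i := by
  apply le_antisymm
  · obtain ⟨x₀, hx₀, h₀⟩ := Finset.exists_mem_eq_inf' hX (fun x : Site d => x i)
    rw [h₀]
    exact Finset.inf'_le (fun x : Site d => x i) (add_mem_map_shift_iff.2 hx₀)
  · refine Finset.le_inf' _ _ fun y hy => ?_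
    rw [mem_map_shift_iff] at hy
    have h1 := Finset.inf'_le (fun x : Site d => x i) hy
    simp only [Pi.sub_apply] at h1
    linarith

/-- Translation preserves the diameter of a region. Bratteli–Robinson II §6.2.1. [folklore] -/
theorem diam_map_shift (X : Finset (Site d)) (v : Site d) :
    Metric.diam (((X.map (Site.shift v).toEmbedding : Finset (Site d))) : Set (Site d)) =
      Metric.diam (X : Set (Site d)) := by
  apply le_antisymm
  · refine Metric.diam_le_of_forall_dist_le Metric.diam_nonneg fun x hx y hy => ?_
    rw [Finset.mem_coe, mem_map_shift_iff] at hx hy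
    have h := Metric.dist_le_diam_of_mem X.finite_toSet.isBounded hx hy
    rwa [dist_sub_right] at h
  · refine Metric.diam_le_of_forall_dist_le Metric.diam_nonneg fun x hx y hy => ?_
    have h := Metric.dist_le_diam_of_mem (X.map (Site.shift v).toEmbedding).finite_toSet.isBounded
      (add_mem_map_shift_iff.2 hx) (add_mem_map_shift_iff.2 hy)
    rwa [dist_add_right] at h

end Shift

/-! ### The projection to the torus and shifts -/

section Proj

variable (Ls : Fin d → ℕ)

/-- `proj (x + v) = proj x + proj v`. Friedli–Velenik §3.1. [folklore] -/
theorem rectTorusProj_add (x v : Site d) :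
    RectTorus.proj Ls (x + v) = RectTorus.proj Ls x + RectTorus.proj Ls v := by
  funext i
  simp [RectTorus.proj_apply]

/-- `proj (x - v) = proj x - proj v`. Friedli–Velenik §3.1. [folklore] -/
theorem rectTorusProj_sub (x v : Site d) :
    RectTorus.proj Ls (x - v) = RectTorus.proj Ls x - RectTorus.proj Ls v := by
  funext i
  simp [RectTorus.proj_apply]

/-- `proj p = 0` iff `p` is a period vector. Friedli–Velenik §3.1. [folklore] -/
theorem rectTorusProj_eq_zero_iff (p : Site d) :
    RectTorus.proj Ls p = 0 ↔ ∀ i, (Ls i : ℤ) ∣ p i := by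
  constructor
  · intro h i
    have hi := congrFun h i
    rw [RectTorus.proj_apply, Pi.zero_apply] at hi
    exact (ZMod.intCast_zmod_eq_zero_iff_dvd _ _).1 hi
  · intro h
    funext i
    rw [RectTorus.proj_apply, Pi.zero_apply]
    exact (ZMod.intCast_zmod_eq_zero_iff_dvd _ _).2 (h i)

/-- `y + proj v ∈ proj (X + v) ↔ y ∈ proj X`. Friedli–Velenik §3.1. [folklore] -/
theorem add_mem_image_proj_map_shift_iff (X : Finset (Site d)) (v : Site d) (y : RectTorusSite Ls) :
    y + RectTorus.proj Ls v ∈ (X.map (Site.shift v).toEmbedding).image (RectTorus.proj Ls) ↔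
      y ∈ X.image (RectTorus.proj Ls) := by
  simp only [Finset.mem_image]
  constructor
  · rintro ⟨x', hx', hy⟩
    rw [mem_map_shift_iff] at hx'
    refine ⟨x' - v, hx', ?_⟩
    rw [rectTorusProj_sub, hy, add_sub_cancel_right]
  · rintro ⟨x, hx, rfl⟩
    exact ⟨x + v, add_mem_map_shift_iff.2 hx, rectTorusProj_add Ls x v⟩

end Proj

/-! ### Covariance of wrapped terms -/

section Wrap

variable (Ls : Fin d → ℕ)

/-- `wrapTerm Ls X 0 = 0`. Bratteli–Robinson II §6.2.1. [folklore] -/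
theorem wrapTerm_zero (X : Finset (Site d)) :
    wrapTerm Ls X (0 : Matrix (X → Fin q) (X → Fin q) ℂ) = 0 := by
  classical
  ext σ τ
  simp only [wrapTerm, of_apply, Matrix.zero_apply]
  split_ifs <;> rfl

variable [∀ i, NeZero (Ls i)]

/-- **Covariance of wrapping**: the torus translate by `proj v` of the wrapped term of `X` is the
wrapped term of `X + v` of the transported matrix, `τ_{proj v}(wrap_X A) = wrap_{X+v}(τ_v A)`.
Bratteli–Robinson II §6.2.1, eqs. (6.2.2)–(6.2.3); Hastings (2004) §II. [folklore] -/
theorem reindexOp_addRight_wrapTerm (v : Site d) (X : Finset (Site d))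
    (A : Matrix (X → Fin q) (X → Fin q) ℂ) :
    reindexOp (Equiv.addRight (RectTorus.proj Ls v)) (wrapTerm Ls X A) =
      wrapTerm Ls (X.map (Site.shift v).toEmbedding)
        (transportOp (finsetMapEquiv (Site.shift v).toEmbedding X) A) := by
  classical
  ext σ τ
  rw [reindexOp_apply]
  simp only [wrapTerm, of_apply, Equiv.coe_addRight, transportOp_apply]
  have hiff : (∀ y, y ∉ X.image (RectTorus.proj Ls) →
      σ (y + RectTorus.proj Ls v) = τ (y + RectTorus.proj Ls v)) ↔
      (∀ y, y ∉ (X.map (Site.shift v).toEmbedding).image (RectTorus.proj Ls) → σ y = τ y) := by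
    constructor
    · intro h y hy
      have hy' : y - RectTorus.proj Ls v ∉ X.image (RectTorus.proj Ls) := fun hm =>
        hy (by rwa [← add_mem_image_proj_map_shift_iff Ls X v, sub_add_cancel] at hm)
      have h1 := h _ hy'
      rwa [sub_add_cancel] at h1
    · intro h y hy
      exact h _ fun hm => hy ((add_mem_image_proj_map_shift_iff Ls X v y).1 hm)
  have hσ : (fun x : ↥X => σ (RectTorus.proj Ls (x : Site d) + RectTorus.proj Ls v)) =
      fun x : ↥X => σ (RectTorus.proj Ls
        ((finsetMapEquiv (Site.shift v).toEmbedding X x : ↥(X.map (Site.shift v).toEmbedding)) :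
          Site d)) := by
    funext x
    rw [coe_finsetMapEquiv_apply, Equiv.coe_toEmbedding, Site.shift_apply, rectTorusProj_add]
  have hτ : (fun x : ↥X => τ (RectTorus.proj Ls (x : Site d) + RectTorus.proj Ls v)) =
      fun x : ↥X => τ (RectTorus.proj Ls
        ((finsetMapEquiv (Site.shift v).toEmbedding X x : ↥(X.map (Site.shift v).toEmbedding)) :
          Site d)) := by
    funext x
    rw [coe_finsetMapEquiv_apply, Equiv.coe_toEmbedding, Site.shift_apply, rectTorusProj_add]
  split_ifs with h1 h2
  · rw [hσ, hτ]
  · exact absurd (hiff.1 h1) h2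
  · exact absurd (hiff.2 ‹_›) h1
  · rfl

/-- For a translation-invariant interaction, **the wrapped term of `X + v` is the torus translate
of the wrapped term of `X`**. Bratteli–Robinson II §6.2.1, eq. (6.2.3); Hastings (2004) §II.
[folklore] -/
theorem wrapTerm_map_shift_of_isTranslationInvariant {Φ : LatticeInteraction d q}
    (hT : Φ.IsTranslationInvariant) (v : Site d) (X : Finset (Site d)) :
    wrapTerm Ls (X.map (Site.shift v).toEmbedding) (Φ (X.map (Site.shift v).toEmbedding)) =
      reindexOp (Equiv.addRight (RectTorus.proj Ls v)) (wrapTerm Ls X (Φ X)) := by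
  rw [hT v X, reindexOp_addRight_wrapTerm]

/-- Translating by `0` on the torus is the identity on observables. [folklore] -/
theorem reindexOp_addRight_zero {Λ : Type*} [Fintype Λ] [DecidableEq Λ] [AddGroup Λ]
    (A : Op Λ q) : reindexOp (Equiv.addRight (0 : Λ)) A = A := by
  ext σ τ
  rw [reindexOp_apply]
  simp

/-- **Wrapped terms of a translation-invariant interaction are invariant under period shifts**:
`wrap_{X+p}(Φ (X+p)) = wrap_X(Φ X)` for `p ∈ Π i, (Ls i)ℤ`. Hastings (2004) §II (periodic boundary
conditions). [folklore] -/
theorem wrapTerm_map_shift_of_dvd {Φ : LatticeInteraction d q} (hT : Φ.IsTranslationInvariant)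
    {p : Site d} (hp : ∀ i, (Ls i : ℤ) ∣ p i) (X : Finset (Site d)) :
    wrapTerm Ls (X.map (Site.shift p).toEmbedding) (Φ (X.map (Site.shift p).toEmbedding)) =
      wrapTerm Ls X (Φ X) := by
  rw [wrapTerm_map_shift_of_isTranslationInvariant Ls hT, (rectTorusProj_eq_zero_iff Ls p).2 hp,
    reindexOp_addRight_zero]

end Wrap

/-! ### Normalisation of regions into the fundamental domain -/

section Normalize

variable (Ls : Fin d → ℕ)

/-- The period vector `p ∈ Π i, (Ls i)ℤ` with `min_X x_i + p_i = (min_X x_i) mod Ls i` for every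
coordinate (`0` for `X = ∅`). Hastings (2004) §II (choice of representatives). [folklore] -/
def wrapShiftVec (X : Finset (Site d)) : Site d := fun i =>
  if h : X.Nonempty then -((Ls i : ℤ) * (X.inf' h (fun x => x i) / (Ls i : ℤ))) else 0

/-- The normalisation `X + wrapShiftVec Ls X` of a region: its translate by a period vector whose
coordinatewise minimum lies in the fundamental domain `Π i, [0, Ls i)`.
Hastings (2004) §II. [folklore] -/
def wrapNormalize (X : Finset (Site d)) : Finset (Site d) :=
  X.map (Site.shift (wrapShiftVec Ls X)).toEmbedding

/-- `wrapShiftVec` is a period vector. [folklore] -/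
theorem dvd_wrapShiftVec (X : Finset (Site d)) (i : Fin d) : (Ls i : ℤ) ∣ wrapShiftVec Ls X i := by
  unfold wrapShiftVec
  split_ifs
  · exact (dvd_mul_right _ _).neg_right
  · exact dvd_zero _

/-- The normalisation of a nonempty region is nonempty. [folklore] -/
theorem wrapNormalize_nonempty {X : Finset (Site d)} (hX : X.Nonempty) : (wrapNormalize Ls X).Nonempty :=
  hX.map

/-- The coordinatewise minimum of the normalisation is the residue of the minimum:
`min_{N X} x_i = (min_X x_i) mod Ls i`. [folklore] -/
theorem inf'_wrapNormalize {X : Finset (Site d)} (hX : X.Nonempty) (i : Fin d)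
    (h' : (wrapNormalize Ls X).Nonempty) :
    (wrapNormalize Ls X).inf' h' (fun x => x i) = X.inf' hX (fun x => x i) % (Ls i : ℤ) := by
  unfold wrapNormalize at h' ⊢
  rw [inf'_map_shift hX]
  simp only [wrapShiftVec, dif_pos hX]
  linarith [Int.emod_add_mul_ediv (X.inf' hX (fun x => x i)) (Ls i)]

/-- The normalisation of a nonempty region has its coordinatewise minimum in the fundamental
domain `Π i, [0, Ls i)` (all sides nonzero). Hastings (2004) §II. [folklore] -/
theorem inf'_wrapNormalize_mem [∀ i, NeZero (Ls i)] {X : Finset (Site d)} (hX : X.Nonempty)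
    (i : Fin d) (h' : (wrapNormalize Ls X).Nonempty) :
    0 ≤ (wrapNormalize Ls X).inf' h' (fun x => x i) ∧
      (wrapNormalize Ls X).inf' h' (fun x => x i) < Ls i := by
  rw [inf'_wrapNormalize Ls hX]
  have hL : (0 : ℤ) < Ls i := by exact_mod_cast Nat.pos_of_ne_zero (NeZero.ne _)
  exact ⟨Int.emod_nonneg _ hL.ne', Int.emod_lt_of_pos _ hL⟩

/-- The diameter of the normalisation is the diameter. [folklore] -/
theorem diam_wrapNormalize (X : Finset (Site d)) :
    Metric.diam ((wrapNormalize Ls X : Finset (Site d)) : Set (Site d)) = Metric.diam (X : Set (Site d)) :=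
  diam_map_shift X _

/-- **The normalisation of a small nonempty region is a wrap representative.**
Hastings (2004) §II. [folklore] -/
theorem isWrapRepresentative_wrapNormalize [∀ i, NeZero (Ls i)] {X : Finset (Site d)}
    (hX : X.Nonempty) (hdiam : ∀ i, 2 * Metric.diam (X : Set (Site d)) < Ls i) :
    IsWrapRepresentative Ls (wrapNormalize Ls X) :=
  ⟨wrapNormalize_nonempty Ls hX, fun i => inf'_wrapNormalize_mem Ls hX i _, fun i => by
    rw [diam_wrapNormalize]; exact hdiam i⟩

/-- **A region with minimum in the fundamental domain, shifted by a period vector, normalises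
back to itself.** Hastings (2004) §II. [folklore] -/
theorem wrapNormalize_map_shift_of_dvd [∀ i, NeZero (Ls i)] {X : Finset (Site d)} (hX : X.Nonempty)
    (hdom : ∀ i, 0 ≤ X.inf' hX (fun x => x i) ∧ X.inf' hX (fun x => x i) < Ls i)
    {p : Site d} (hp : ∀ i, (Ls i : ℤ) ∣ p i) :
    wrapNormalize Ls (X.map (Site.shift p).toEmbedding) = X := by
  have hv : wrapShiftVec Ls (X.map (Site.shift p).toEmbedding) = -p := by
    have hne : (X.map (Site.shift p).toEmbedding).Nonempty := hX.map
    funext i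
    simp only [wrapShiftVec, dif_pos hne]
    rw [inf'_map_shift hX, Pi.neg_apply]
    obtain ⟨k, hk⟩ := hp i
    have hL : (Ls i : ℤ) ≠ 0 := by exact_mod_cast NeZero.ne (Ls i)
    rw [hk, Int.add_mul_ediv_left _ _ hL, Int.ediv_eq_zero_of_lt (hdom i).1 (hdom i).2, zero_add]
  rw [wrapNormalize, hv, map_shift_map_shift, add_neg_cancel, map_shift_zero]

/-- A wrap representative normalises to itself. Hastings (2004) §II. [folklore] -/
theorem wrapNormalize_of_isWrapRepresentative [∀ i, NeZero (Ls i)] {X : Finset (Site d)}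
    (hX : IsWrapRepresentative Ls X) : wrapNormalize Ls X = X := by
  obtain ⟨hne, hdom, -⟩ := hX
  have h := wrapNormalize_map_shift_of_dvd Ls hne hdom (p := 0) (fun i => dvd_zero _)
  rwa [map_shift_zero] at h

end Normalize

/-! ### The finite set of wrap representatives -/

section RepSet

variable (Ls : Fin d → ℕ)

/-- The box `Π i, [0, 2 Ls i)` containing every wrap representative. [folklore] -/
def wrapRepBox : Finset (Site d) := Fintype.piFinset fun i => Finset.Ico (0 : ℤ) (2 * Ls i)

/-- **Wrap representatives lie in the box `Π i, [0, 2 Ls i)`**: the minimum is in `[0, Ls i)` and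
the spread is at most `diam X < Ls i / 2`. Hastings (2004) §II. [folklore] -/
theorem subset_wrapRepBox {X : Finset (Site d)} (hX : IsWrapRepresentative Ls X) : X ⊆ wrapRepBox Ls := by
  obtain ⟨hne, hdom, hdiam⟩ := hX
  intro x hx
  rw [wrapRepBox, Fintype.mem_piFinset]
  intro i
  rw [Finset.mem_Ico]
  obtain ⟨x₀, hx₀, h₀⟩ := Finset.exists_mem_eq_inf' hne (fun x : Site d => x i)
  have hinf : X.inf' hne (fun x => x i) ≤ x i := Finset.inf'_le _ hx
  refine ⟨(hdom i).1.trans hinf, ?_⟩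
  have hdist : dist x x₀ ≤ Metric.diam (X : Set (Site d)) :=
    Metric.dist_le_diam_of_mem X.finite_toSet.isBounded hx hx₀
  have hcoord : ((x i : ℤ) : ℝ) - ((x₀ i : ℤ) : ℝ) ≤ dist x x₀ := by
    have h1 : dist (x i) (x₀ i) ≤ dist x x₀ := dist_le_pi_dist x x₀ i
    rw [Int.dist_eq] at h1
    exact (le_abs_self _).trans h1
  have hx0L : ((x₀ i : ℤ) : ℝ) < Ls i := by
    have h2 := (hdom i).2
    rw [h₀] at h2
    exact_mod_cast h2
  have hreal : ((x i : ℤ) : ℝ) < 2 * (Ls i : ℝ) := by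
    have hd := hdiam i
    have h0 := Metric.diam_nonneg (s := (X : Set (Site d)))
    linarith
  exact_mod_cast hreal

/-- The wrap representatives form a finite family (they lie in a fixed finite box).
Hastings (2004) §II. [folklore] -/
theorem finite_setOf_isWrapRepresentative :
    {X : Finset (Site d) | IsWrapRepresentative Ls X}.Finite :=
  (wrapRepBox Ls).powerset.finite_toSet.subset fun _ hX =>
    Finset.mem_coe.2 (Finset.mem_powerset.2 (subset_wrapRepBox Ls hX))

/-- The finite set of all wrap representatives of the torus `Π i, ℤ/(Ls i)ℤ`.
Hastings (2004) §II. [folklore] -/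
def wrapRepSet : Finset (Finset (Site d)) := (finite_setOf_isWrapRepresentative Ls).toFinset

/-- Membership in `wrapRepSet` is being a wrap representative. [folklore] -/
theorem mem_wrapRepSet {X : Finset (Site d)} : X ∈ wrapRepSet Ls ↔ IsWrapRepresentative Ls X := by
  rw [wrapRepSet, Set.Finite.mem_toFinset, Set.mem_setOf_eq]

/-- **The torus interaction is a finite sum**: its term at `Y` is the sum of the wrapped terms over
the wrap representatives (a finite set) projecting onto `Y`. Hastings (2004) §II. [folklore] -/
theorem rectTorusInteraction_eq_sum (Φ : LatticeInteraction d q) (Y : Finset (RectTorusSite Ls)) :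
    rectTorusInteraction Φ Ls Y =
      ∑ X ∈ (wrapRepSet Ls).filter (fun X => X.image (RectTorus.proj Ls) = Y), wrapTerm Ls X (Φ X) := by
  rw [rectTorusInteraction_apply]
  refine finsum_cond_eq_sum_of_cond_iff _ fun {X} _ => ?_
  rw [Finset.mem_filter, mem_wrapRepSet]

variable [∀ i, NeZero (Ls i)]

/-- **The torus Hamiltonian is the finite sum of the wrapped terms over all wrap representatives**:
`H_𝕋 = Σ_{X ∈ wrapRepSet} wrap_X (Φ X)`. Hastings (2004) §II. [folklore] -/
theorem rectTorusHamiltonian_eq_sum (Φ : LatticeInteraction d q) :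
    rectTorusHamiltonian Φ Ls = ∑ X ∈ wrapRepSet Ls, wrapTerm Ls X (Φ X) := by
  rw [rectTorusHamiltonian, localHamiltonian]
  simp_rw [rectTorusInteraction_eq_sum]
  exact Finset.sum_fiberwise_of_maps_to (fun X _ => Finset.mem_powerset.2 (Finset.subset_univ _)) _

/-- The translate-and-normalise map `X ↦ N(X + v)` sends wrap representatives to wrap
representatives. Hastings (2004) §II. [folklore] -/
theorem wrapNormalize_map_shift_mem {X : Finset (Site d)} (hX : X ∈ wrapRepSet Ls) (v : Site d) :
    wrapNormalize Ls (X.map (Site.shift v).toEmbedding) ∈ wrapRepSet Ls := by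
  rw [mem_wrapRepSet] at hX ⊢
  obtain ⟨hne, -, hdiam⟩ := hX
  refine isWrapRepresentative_wrapNormalize Ls hne.map fun i => ?_
  rw [diam_map_shift]
  exact hdiam i

/-- `N(N(X + v) - v) = X` for a wrap representative `X`: translate-and-normalise by `-v` inverts
translate-and-normalise by `v` on representatives. Hastings (2004) §II. [folklore] -/
theorem wrapNormalize_map_shift_inv {X : Finset (Site d)} (hX : X ∈ wrapRepSet Ls) (v : Site d) :
    wrapNormalize Ls ((wrapNormalize Ls (X.map (Site.shift v).toEmbedding)).map
      (Site.shift (-v)).toEmbedding) = X := by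
  rw [mem_wrapRepSet] at hX
  obtain ⟨hne, hdom, -⟩ := hX
  have h1 : (wrapNormalize Ls (X.map (Site.shift v).toEmbedding)).map (Site.shift (-v)).toEmbedding =
      X.map (Site.shift (wrapShiftVec Ls (X.map (Site.shift v).toEmbedding))).toEmbedding := by
    rw [wrapNormalize, map_shift_map_shift, map_shift_map_shift,
      show v + (wrapShiftVec Ls (X.map (Site.shift v).toEmbedding) + -v) =
        wrapShiftVec Ls (X.map (Site.shift v).toEmbedding) by abel]
  rw [h1]
  exact wrapNormalize_map_shift_of_dvd Ls hne hdom (dvd_wrapShiftVec Ls _)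

/-- **The torus Hamiltonian of a translation-invariant interaction is translation invariant**:
`τ_{proj v} (H_𝕋) = H_𝕋` for every `v ∈ ℤ^d` (re-summation over representatives via the bijection
`X ↦ N(X + v)` of `wrapRepSet`, using covariance and period invariance of wrapped terms).
Nachtergaele–Sims (2007) §1.2 (LSM2, `[T, H] = 0`); Hastings (2004) §II. [folklore] -/
theorem reindexOp_addRight_rectTorusHamiltonian {Φ : LatticeInteraction d q}
    (hT : Φ.IsTranslationInvariant) (v : Site d) :
    reindexOp (Equiv.addRight (RectTorus.proj Ls v)) (rectTorusHamiltonian Φ Ls) =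
      rectTorusHamiltonian Φ Ls := by
  rw [rectTorusHamiltonian_eq_sum, map_sum]
  have hsummand : ∀ X ∈ wrapRepSet Ls,
      reindexOp (Equiv.addRight (RectTorus.proj Ls v)) (wrapTerm Ls X (Φ X)) =
        wrapTerm Ls (wrapNormalize Ls (X.map (Site.shift v).toEmbedding))
          (Φ (wrapNormalize Ls (X.map (Site.shift v).toEmbedding))) := by
    intro X _
    rw [← wrapTerm_map_shift_of_isTranslationInvariant Ls hT, wrapNormalize,
      wrapTerm_map_shift_of_dvd Ls hT (dvd_wrapShiftVec Ls _)]
  rw [Finset.sum_congr rfl hsummand]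
  refine Finset.sum_nbij' (fun X => wrapNormalize Ls (X.map (Site.shift v).toEmbedding))
    (fun X => wrapNormalize Ls (X.map (Site.shift (-v)).toEmbedding))
    (fun X hX => wrapNormalize_map_shift_mem Ls hX v)
    (fun X hX => wrapNormalize_map_shift_mem Ls hX (-v))
    (fun X hX => wrapNormalize_map_shift_inv Ls hX v)
    (fun X hX => ?_) (fun X _ => rfl)
  have h := wrapNormalize_map_shift_inv Ls hX (-v)
  rwa [neg_neg] at h

end RepSet

end Literature.MathematicalPhysics.QuantumLattice

end
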